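import Mathlib
import Literature.MathematicalPhysics.QuantumFieldTheory.Balaban1983to89.B6Lemma21PrintedDomains

/-!
# `Balaban1983to89.B6Dist246InterfaceWitness` — [Balaban1984PropagatorsII] (2.46) p. 231 ACROSS AN INTERFACE Σ_{j+1}: two
# blocks that TOUCH (touching distance d_R2 = 1) can be at lattice-contour distance d_R0 ≥ ⌊L/2⌋ — a kernel witness for the
# reading note HOME/GAPS.md G-B6-22 ≡ G-B6-p29-01 and for the located comparison G-pv08-1 «d(y, y″) ≤ O(1)·(Lʲη)⁻¹|y − y″|»
# behind the silent step (2.44) ⇒ (2.51): L-free under R2, of order L under R0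

statement-level skeleton of published theorems with citation tags; proofs where landed; nothing here is a claim about the Yang–Mills mass gap

CITATION HEADER (lean-in-tree rule 2026-08-18).  Source: T. Bałaban, *Propagators and renormalization transformations for
lattice gauge theories. II*, Commun. Math. Phys. **96**, 223–250 (1984), doi:10.1007/bf01240221 [Balaban1984PropagatorsII]
(cell paper B6; PDF held `paper:balaban1984-cmp96-propagators-rt-ii`, journal page = PDF page + 222; pp. 224, 230–232 re-read
this generation from the text layer).  WHAT IS REPRODUCED: the status annotation of lit-balaban SKELETON rows **B6.Eq2.45**
((2.46): the readings R0/R2 of the bonds across an interface) and **B6.Eq2.56** ((2.51)–(2.57): the comparison of d with the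
scaled euclidean distance) — cells only, no head change; nothing of [B6] is refuted.  Unit `lit-balaban-p29` (Phase-2 proof
seat p29, gen 15), HOME `run/shared/lean/pub/lit-balaban/`; B6 fold owner r03, referee ref-4.  IMPORTS, NOT MODIFIED:
`…B6Lemma21PrintedDomains` (this seat, this generation: `Cond22`, `connected_printedDomains`, `tiles_printedDomains`, `SepZd`;
through it `…B15LatticeCubeContours` (`latC`, `LatStep`, `sideZ`, `cornerC`, `latC_adj`, `latC_adj_of_idx_succ`),
`…B15TouchingCubeContours` (`touchC`, `touchC_adj`, `Tiles`), `…B15Ineq147Admissible` (`Touching`), `…B15Ineq147LevelGap`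
(`cube`, `corner`, `CubeSite`, `zoneC`, `toR`, `LayerSepZd`), `…B14DomainGeom` (`cubeIdx`, `IsUnionOfCubes`)).

THE PRINTED TEXT.  p. 231 [PDF 9]: *"We consider a special class of contours Γ. They have the property that a part of Γ
contained in B^j(Λ_j) consists of bonds of the lattice Λ_j. Now we define d(y, y′) = inf_{Γ_{y,y′}} Σ_j (L^jη)^{−1}|Γ_{y,y′} ∩
B^j(Λ_j)| (2.46) … We may extend this definition and define the distance for a pair of arbitrary points x, x′ ∈ T_η putting
d(x, x′) = d(y^j(x), y^{j′}(x′)) if x ∈ B^j(Λ_j), x′ ∈ B^{j′}(Λ_{j′})."*  p. 230 [PDF 8], after (2.44): *"The distance in the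
above inequality is measured on L^{−j}-scale."*; p. 231: *"The inequality (2.44) implies an inequality for the operator R. To
write it we will introduce a new definition of distance"*; p. 232 [PDF 10]: *"From (2.44) and (2.38) we have |(Rλ)(x)| ≤
O(M^{−1}) e^{−δ₀d(x,y)}|λ| if supp λ ⊂ B^j(y), y ∈ Λ_j. (2.51)"*.

THE POINT.  Print fixes the lattice of a bond INSIDE a region B^j(Λ_j) and says nothing about a bond ACROSS an interface; the
tree carries two readings on the ℤᵈ cube carrier (G-B6-22): R2 «two blocks are joined iff they touch» (`touchC`; the k-level
geometries of record of `B6Geom246MultiLevelBox` / `B6Prop22KLevelCensus`; (2.61) only with the L-dependent `K261`) and R0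
«a bond is a bond of the lattice of ONE of its two blocks» (`latC`; Lemma 2.1 with the d-only c₁″, `B15LatticeCubeContours`,
`B6Lemma21PrintedDomains`).  Pointwise d_R2 ≤ d_R0 (`B15LatticeCubeContours.touchC_dist_le_latC_dist`).  THIS FILE shows the
two differ by a factor of order L already between TOUCHING blocks, on a configuration satisfying every hypothesis of every
Lemma-2.1 file of the tree (print's (2.1)–(2.2), the [III] one-cube collar, the ℓ¹ collar — all vacuously: two adjacent
scales need no collar): in d = 2 with Ω₀ = T ⊃ Ω₁ = the half-space {x₂ ≥ 0} (a union of L-blocks) ⊃ Ω₂ = ∅ (`ΩH`), the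
Λ₀-block at (m, −1), 0 ≤ m < L, lies against the −e₂ face of the Λ₁-block B = [0, L)² with base point (0, 0):
`touchC.dist = 1` (`touchC_dist_siteF_siteC`), but **every admissible contour (R0) from it to B has at least min(m, L − m)
bonds** (`le_length_of_walk`; `min_le_latC_dist`), **= ⌊L/2⌋ at the face centre** (`half_le_latC_dist_centre`), and this is
sharp up to one bond (`latC_dist_le`: ≤ m + 1, along the face to the corner).  MECHANISM (§2, valid on EVERY carrier `Z` with
`M₁ = 1`): the potential Φ(s) = distance of the first coordinate of the base point of s to Lℤ (`zd`) changes by at most 1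
along a Λ₀-bond and not at all along a bond of a coarser lattice Λ_n, n ≥ 1 (length Lⁿ ∈ Lℤ) (`abs_phi_sub_phi_le_one`), so
Φ(s) − Φ(t) ≤ (number of bonds) for every R0 contour (`phi_sub_le_length`); Φ = min(m, L − m) at (m, −1) and Φ = 0 at every
block of Λ_n, n ≥ 1.  CONSEQUENCE FOR THE RECORD (exact, no over-claim): the comparison that G-pv08-1 locates behind
(2.44) ⇒ (2.51) and (2.66) — «d(x, y) ≤ O(1)·(Lʲη)^{−1}|x − y| + O(1) within the range of one partition function» — holds with an
L-free O(1) under R2 (p21 `B6Geom246MultiLevelBox.dist_blkOf_le_line`) and only with O(1) = O(L) under R0 (here: euclidean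
block distance 0, scaled distance of the base points ≤ L, d_R0 ≥ ⌊L/2⌋); with print's δ₀ = δ₀(d, L) and L fixed this is a
CONSTANTS-ONLY matter (a factor e^{O(δ₀L)} in the O(1) of (2.51)), recorded so that the R0 constant c₁″ of Lemma 2.1 and an
L-free (2.44) ⇒ (2.51) are not combined in one `B6.BlockData`.  Nothing of [B6] is refuted; no head changes.

WHAT IS PROVED (kernel-checked; no `sorry`; axioms ⊆ {propext, Classical.choice, Quot.sound}; new definitions with bodies:
`zd`, `phi`, `ΩH`, `pt`, `siteF`, `siteC`; 0 new `structure`s, 0 new `def … : Prop` facts).  Main declarations: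
`abs_phi_sub_phi_le_one`, `phi_sub_le_length`, `antitone_ΩH`, `isUnionOfCubes_ΩH`,
`cond22_ΩH`, `layerSepZd_ΩH`, `sepZd_ΩH`, `connected_ΩH`, `touching_siteF_siteC`, `touchC_dist_siteF_siteC`,
`le_length_of_walk`, `min_le_latC_dist`, `latC_dist_le`, `half_le_latC_dist_centre`, `exists_touching_far`.

TYPING ∕ DIVERGENCE (honest).  (a) d = 2, M₁ = 1, scales 0 (unit blocks, Λ₀ = Ω₁ᶜ) and 1 (L-blocks) — the smallest
configuration exhibiting the phenomenon; in d dimensions the same potential summed over the d − 1 transverse coordinates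
gives (d − 1)⌊L/2⌋ at a face centre (not formalised).  (b) The readings R0/R2 themselves are the tree's (`latC`, `touchC`);
print does not decide between them (G-B6-22).  (c) «O(1)» in (2.51)/(2.66) is print's; which constants may depend on L is
not printed at that place (δ₀ of Prop. 2.2 depends on d and L).  HONEST SCOPE: a two-block lattice computation making a
reading note quantitative; NOT a refutation of any display, NOT progress on any Clay problem.
-/

namespace Literature.MathematicalPhysics.QuantumFieldTheory.Balaban1983to89.B6Dist246InterfaceWitness

open Literature.MathematicalPhysics.QuantumFieldTheory.Balaban1983to89
open B6Geometry B15Ineq147LevelGap B15Ineq147Admissible B14DomainGeom B15TouchingCubeContours B15LatticeCubeContours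
  B6Lemma21PrintedDomains

/-! ## §1 The potential: distance of an integer to the lattice `Lℤ` -/

section Potential

variable {L : ℕ}

/-- Distance of the integer `x` to the lattice `Lℤ` (`L ≥ 1`): `min(x mod L, L − x mod L)`. [folklore] -/
def zd (L : ℕ) (x : ℤ) : ℤ := min (x % (L : ℤ)) ((L : ℤ) - x % (L : ℤ))

/-- The residue of `x + 1`: either the residue of `x` plus one, or zero (when the residue of `x` is `L − 1`). [folklore] -/
private theorem emod_succ (hL : 0 < L) (x : ℤ) :
    (x + 1) % (L : ℤ) = x % (L : ℤ) + 1 ∨ ((x + 1) % (L : ℤ) = 0 ∧ x % (L : ℤ) + 1 = L) := by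
  have hL' : (0 : ℤ) < L := by exact_mod_cast hL
  have hx : x % (L : ℤ) + x / (L : ℤ) * (L : ℤ) = x := Int.emod_add_ediv_mul x (L : ℤ)
  have hr0 : 0 ≤ x % (L : ℤ) := Int.emod_nonneg _ hL'.ne'
  have hrL : x % (L : ℤ) < L := Int.emod_lt_of_pos _ hL'
  set r := x % (L : ℤ) with hr
  set q := x / (L : ℤ) with hq
  by_cases h : r + 1 < L
  · left
    have e : x + 1 = (r + 1) + (L : ℤ) * q := by rw [← hx]; ring
    rw [e, Int.add_mul_emod_self_left, Int.emod_eq_of_lt (by omega) h]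
  · right
    refine ⟨?_, by omega⟩
    have e : x + 1 = (L : ℤ) * (q + 1) := by
      have : (r : ℤ) + 1 = L := by omega
      rw [← hx, ← this]; ring
    rw [e, Int.mul_emod_right]

/-- **One unit step changes the potential by at most one.** [folklore] -/
private theorem abs_zd_succ_sub_le (hL : 0 < L) (x : ℤ) : |zd L (x + 1) - zd L x| ≤ 1 := by
  have hL' : (0 : ℤ) < L := by exact_mod_cast hL
  have hr0 : 0 ≤ x % (L : ℤ) := Int.emod_nonneg _ hL'.ne'
  have hrL : x % (L : ℤ) < L := Int.emod_lt_of_pos _ hL'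
  unfold zd
  rw [abs_le, min_def, min_def]
  rcases emod_succ hL x with h | ⟨h1, h2⟩
  · rw [h]
    split_ifs <;> constructor <;> omega
  · rw [h1]
    split_ifs <;> constructor <;> omega

/-- A step by a multiple of `L` does not change the potential. [folklore] -/
private theorem zd_add_mul (x c : ℤ) : zd L (x + (L : ℤ) * c) = zd L x := by
  unfold zd
  rw [Int.add_mul_emod_self_left]

/-- The potential vanishes on `Lℤ`. [folklore] -/
private theorem zd_mul (c : ℤ) : zd L ((L : ℤ) * c) = 0 := by
  unfold zd
  simp

/-- The potential of a residue `0 ≤ m < L` is `min(m, L − m)`. [folklore] -/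
private theorem zd_of_lt {m : ℤ} (h0 : 0 ≤ m) (hm : m < L) : zd L m = min m ((L : ℤ) - m) := by
  unfold zd
  rw [Int.emod_eq_of_lt h0 hm]

end Potential

/-! ## §2 The potential is 1-Lipschitz along EVERY lattice contour of a cube model with `M₁ = 1` (any carrier `Z`, any `d ≥ 1`) -/

section Lipschitz

variable {d : ℕ} [NeZero d] {L : ℕ} {Z : ℕ → Set (Fin d → ℤ)}

/-- The potential of a block: distance of the first coordinate of its base point to `Lℤ`.
[cite: Balaban1984PropagatorsII, (2.45)–(2.46) p.231] -/
def phi (L : ℕ) (s : CubeSite 1 L Z) : ℤ := zd L (cornerC s 0)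

/-- **Φ changes by at most 1 along an admissible bond (reading R0)**: a bond of Λ₀ moves the base point by one unit, a bond of
Λ_n, n ≥ 1, by `Lⁿ ∈ Lℤ` (no change of Φ), a bond along another axis leaves the first coordinate alone.
[cite: Balaban1984PropagatorsII, (2.46) p.231] -/
theorem abs_phi_sub_phi_le_one (hL : 0 < L) {s t : CubeSite 1 L Z} (h : (latC 1 L Z).Adj s t) :
    |phi L s - phi L t| ≤ 1 := by
  -- one direction of `LatStep` suffices, by symmetry of `|·|`
  suffices key : ∀ {u v : CubeSite 1 L Z}, LatStep u v → |phi L u - phi L v| ≤ 1 by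
    obtain ⟨-, huv | hvu⟩ := latC_adj.mp h
    · exact key huv
    · rw [abs_sub_comm]; exact key hvu
  intro u v huv
  obtain ⟨μ, hμ⟩ := huv
  unfold phi
  have h0 : cornerC v 0 = cornerC u 0 + (Pi.single μ (sideZ 1 L (zoneC u)) : Fin d → ℤ) 0 := by
    rw [hμ]; rfl
  by_cases hμ0 : μ = 0
  · subst hμ0
    rw [Pi.single_eq_same] at h0
    rw [h0, sideZ, one_mul]
    rcases Nat.eq_zero_or_pos (zoneC u) with hz | hz
    · -- a bond of Λ₀: one unit
      rw [hz, pow_zero, Nat.cast_one, abs_sub_comm]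
      exact abs_zd_succ_sub_le hL _
    · -- a bond of Λ_n, n ≥ 1: a multiple of L
      obtain ⟨n, hn⟩ := Nat.exists_eq_add_of_le hz
      have e : ((L ^ zoneC u : ℕ) : ℤ) = (L : ℤ) * ((L ^ n : ℕ) : ℤ) := by
        rw [hn, pow_add, pow_one]; push_cast; ring
      rw [e, zd_add_mul, sub_self, abs_zero]
      exact zero_le_one
  · rw [Pi.single_eq_of_ne (Ne.symm hμ0) ] at h0
    · rw [add_zero] at h0
      rw [h0, sub_self, abs_zero]
      exact zero_le_one

/-- **Φ(s) − Φ(t) ≤ (number of bonds) along every lattice contour from s to t.** [cite: Balaban1984PropagatorsII, (2.46) p.231] -/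
theorem phi_sub_le_length (hL : 0 < L) {s t : CubeSite 1 L Z} (p : (latC 1 L Z).Walk s t) :
    phi L s - phi L t ≤ (p.length : ℤ) := by
  induction p with
  | nil => simp
  | @cons a b c h q ih =>
    have h1 := abs_phi_sub_phi_le_one hL h
    rw [abs_le] at h1
    rw [SimpleGraph.Walk.length_cons]
    push_cast
    linarith [h1.2]

end Lipschitz

/-! ## §3 The configuration: `Ω₀ = T ⊃ Ω₁ = {x₂ ≥ 0} ⊃ Ω₂ = ∅` in d = 2 — print's (2.1)–(2.2) with k = 1, and every collar
hypothesis of the tree, vacuously -/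

section Config

/-- The domains: `Ω 0 = T`, `Ω 1` = the upper half-plane (a union of L-blocks for every L), `Ω j = ∅` for `j ≥ 2`.
[cite: Balaban1984PropagatorsII, (2.1) p.224] -/
def ΩH : ℕ → Set (Fin 2 → ℤ)
  | 0 => Set.univ
  | 1 => {x | 0 ≤ x 1}
  | _ + 2 => ∅

variable {L : ℕ}

/-- (2.1): the domains are nested. [cite: Balaban1984PropagatorsII, (2.1) p.224] -/
theorem antitone_ΩH : Antitone ΩH := by
  refine antitone_nat_of_succ_le fun n => ?_
  match n with
  | 0 => exact Set.subset_univ _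
  | 1 => exact Set.empty_subset _
  | _ + 2 => exact Set.empty_subset _

/-- (2.1): every `Ω j` is a union of `Lʲ·1`-blocks (the half-plane is a union of L-blocks). [cite: Balaban1984PropagatorsII, (2.1) p.224] -/
theorem isUnionOfCubes_ΩH (hL : 0 < L) : ∀ j, IsUnionOfCubes (L ^ j * 1) (ΩH j) := by
  intro j x y hxy
  match j with
  | 0 => simp [ΩH]
  | 1 =>
    have h1 := congrFun hxy 1
    unfold cubeIdx at h1
    have hL' : (0 : ℤ) < ((L ^ 1 * 1 : ℕ) : ℤ) := by positivity
    show 0 ≤ x 1 ↔ 0 ≤ y 1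
    rw [← Int.ediv_nonneg_iff_of_pos hL', ← Int.ediv_nonneg_iff_of_pos (a := y 1) hL', h1]
  | _ + 2 => simp [ΩH]

/-- (2.2) holds for every count RM (two adjacent scales only: the collar conditions are void). [cite: Balaban1984PropagatorsII, (2.2) p.224] -/
theorem cond22_ΩH (RM : ℕ) : Cond22 ΩH L RM := by
  intro j a b ha hb
  match j with
  | 0 => exact absurd (Set.mem_univ a) ha
  | 1 => exact absurd hb (Set.notMem_empty b)
  | _ + 2 => exact absurd hb (Set.notMem_empty b)

/-- The [III]/[IV] one-cube collar holds too (vacuously), for every `M`. [cite: Balaban1989LargeFieldI, p.179] -/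
theorem layerSepZd_ΩH (M : ℕ) : LayerSepZd (fun j => (ΩH j)ᶜ) M L := by
  intro n a b ha hb
  match n with
  | 0 => exact absurd ha (by simp [ΩH])
  | 1 => exact absurd (by simp [ΩH]) hb
  | _ + 2 => exact absurd (by simp [ΩH]) hb

/-- The ℓ¹ collar holds too, for every `N`. [cite: Balaban1984PropagatorsII, (2.2) p.224] -/
theorem sepZd_ΩH (N : ℕ) : SepZd (fun j => (ΩH j)ᶜ) 1 L N := sepZd_of_cond22 (cond22_ΩH N)

/-- The covering (2.4) (`L ≥ 1`). [cite: Balaban1984PropagatorsII, (2.4) p.224] -/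
theorem tiles_ΩH (hL : 1 ≤ L) : Tiles 1 L (fun j => (ΩH j)ᶜ) :=
  tiles_printedDomains (M := 1) (k := 1) hL (isUnionOfCubes_ΩH (by omega)) rfl rfl

/-- Admissible contours exist on the configuration (`L ≥ 2`). [cite: Balaban1984PropagatorsII, (2.46) p.231] -/
theorem connected_ΩH (hL : 2 ≤ L) : (latC 1 L (fun j => (ΩH j)ᶜ)).Connected :=
  connected_printedDomains (R := 1) (M := 1) (k := 1) antitone_ΩH rfl rfl (isUnionOfCubes_ΩH (by omega)) (cond22_ΩH _)
    le_rfl hL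

/-- The lattice point `(a, b) ∈ ℤ²`. [folklore] -/
def pt (a b : ℤ) : Fin 2 → ℤ := ![a, b]

/-- First coordinate of `pt`. [folklore] -/
private theorem pt_zero (a b : ℤ) : pt a b 0 = a := rfl

/-- Second coordinate of `pt`. [folklore] -/
private theorem pt_one (a b : ℤ) : pt a b 1 = b := rfl

/-- The Λ₀-block (a lattice point of Ω₁ᶜ) at `(m, −1)`, just below the interface `x₂ = 0`.
[cite: Balaban1984PropagatorsII, (2.3) p.224] -/
def siteF (L : ℕ) (m : ℤ) : CubeSite 1 L (fun j => (ΩH j)ᶜ) :=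
  ⟨(0, pt m (-1)), fun x hx => by
    have h := hx 1
    simp only [pow_zero, mul_one, Nat.cast_one, one_mul, pt_one] at h
    constructor
    · show ¬ (0 ≤ x 1); omega
    · show x ∉ (Set.univ : Set (Fin 2 → ℤ))ᶜ; simp⟩

/-- The Λ₁-block `B = [0, L)²` of Ω₁ with base point `(0, 0)` (`L ≥ 1`). [cite: Balaban1984PropagatorsII, (2.3) p.224] -/
def siteC (L : ℕ) : CubeSite 1 L (fun j => (ΩH j)ᶜ) :=
  ⟨(1, pt 0 0), fun x hx => by
    have h := hx 1
    simp only [pow_one, one_mul, pt_one, mul_zero, zero_add, mul_one] at h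
    constructor
    · show x ∉ (∅ : Set (Fin 2 → ℤ)); exact Set.notMem_empty x
    · intro hx1; exact hx1 (show 0 ≤ x 1 from h.1)⟩

/-- The base point of the fine block. [folklore] -/
private theorem cornerC_siteF (m : ℤ) : cornerC (siteF L m) = pt m (-1) := by
  funext ν
  show ((1 * L ^ 0 : ℕ) : ℤ) * pt m (-1) ν = pt m (-1) ν
  simp

/-- The base point of the coarse block. [folklore] -/
private theorem cornerC_siteC : cornerC (siteC L) = pt 0 0 := by
  funext ν
  show ((1 * L ^ 1 : ℕ) : ℤ) * pt 0 0 ν = pt 0 0 ν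
  fin_cases ν <;> simp [pt_zero, pt_one]

/-- **The two blocks TOUCH** (`0 ≤ m < L`): the lattice points `(m, −1)` of the fine block and `(m, 0)` of `B` are at sup-distance 1.
[cite: Balaban1984PropagatorsII, (2.46) p.231] -/
theorem touching_siteF_siteC (hL : 0 < L) {m : ℤ} (h0 : 0 ≤ m) (hm : m < L) : Touching (siteF L m) (siteC L) := by
  refine ⟨pt m (-1), ?_, pt m 0, ?_, ?_⟩
  · intro ν
    fin_cases ν <;> simp [pt, siteF]
  · intro ν
    fin_cases ν <;> simp [pt, siteC] <;> omega
  · refine (dist_pi_le_iff zero_le_one).mpr fun ν => ?_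
    rw [Real.dist_eq]
    unfold toR
    fin_cases ν <;> simp [pt]

/-- The two blocks are distinct sites (different scales). [folklore] -/
private theorem siteF_ne_siteC (m : ℤ) : siteF L m ≠ siteC L := by
  intro h
  have h' : (0 : ℕ) = 1 := congrArg (fun s : CubeSite 1 L (fun j => (ΩH j)ᶜ) => s.1.1) h
  omega

/-- **Reading R2: the two blocks are at touching distance ONE.** [cite: Balaban1984PropagatorsII, (2.46) p.231] -/
theorem touchC_dist_siteF_siteC (hL : 0 < L) {m : ℤ} (h0 : 0 ≤ m) (hm : m < L) :
    (touchC 1 L (fun j => (ΩH j)ᶜ)).dist (siteF L m) (siteC L) = 1 :=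
  SimpleGraph.dist_eq_one_iff_adj.mpr (touchC_adj.mpr ⟨siteF_ne_siteC m, touching_siteF_siteC hL h0 hm⟩)

end Config

/-! ## §4 Reading R0: every admissible contour from the fine block to `B` has at least `min(m, L − m)` bonds; sharp up to one -/

section Bounds

variable {L : ℕ}

/-- The potential of the fine block at `(m, −1)`, `0 ≤ m < L`: `min(m, L − m)`. [folklore] -/
private theorem phi_siteF {m : ℤ} (h0 : 0 ≤ m) (hm : m < L) : phi L (siteF L m) = min m ((L : ℤ) - m) := by
  unfold phi
  rw [cornerC_siteF, pt_zero, zd_of_lt h0 hm]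

/-- The potential of the coarse block: 0. [folklore] -/
private theorem phi_siteC : phi L (siteC L) = 0 := by
  unfold phi
  rw [cornerC_siteC, pt_zero]
  have := zd_mul (L := L) 0
  simpa using this

/-- **LOWER BOUND, WALK FORM (reading-independent of connectedness)**: every lattice contour (R0) from the fine block at
`(m, −1)` to the coarse block `B` has at least `min(m, L − m)` bonds (`0 ≤ m < L`, `L ≥ 1`).
[cite: Balaban1984PropagatorsII, (2.46) p.231] -/
theorem le_length_of_walk (hL : 0 < L) {m : ℤ} (h0 : 0 ≤ m) (hm : m < L)
    (p : (latC 1 L (fun j => (ΩH j)ᶜ)).Walk (siteF L m) (siteC L)) : min m ((L : ℤ) - m) ≤ (p.length : ℤ) := by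
  have h := phi_sub_le_length hL p
  rwa [phi_siteF h0 hm, phi_siteC, sub_zero] at h

/-- **LOWER BOUND FOR PRINT'S DISTANCE (2.46) READ LITERALLY**: `d_R0((m,−1), B) ≥ min(m, L − m)` (`L ≥ 2`, so that admissible
contours exist and the distance is attained). [cite: Balaban1984PropagatorsII, (2.46) p.231] -/
theorem min_le_latC_dist (hL : 2 ≤ L) {m : ℤ} (h0 : 0 ≤ m) (hm : m < L) :
    min m ((L : ℤ) - m) ≤ ((latC 1 L (fun j => (ΩH j)ᶜ)).dist (siteF L m) (siteC L) : ℤ) := by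
  obtain ⟨p, hp⟩ := (connected_ΩH hL).exists_walk_length_eq_dist (siteF L m) (siteC L)
  rw [← hp]
  exact le_length_of_walk (by omega) h0 hm p

/-- Neighbouring fine blocks along the face are one Λ₀-bond apart. [cite: Balaban1984PropagatorsII, (2.46) p.231] -/
private theorem adj_siteF_succ (m : ℤ) : (latC 1 L (fun j => (ΩH j)ᶜ)).Adj (siteF L m) (siteF L (m + 1)) := by
  refine latC_adj_of_idx_succ (μ := 0) rfl ?_
  show pt (m + 1) (-1) = Function.update (pt m (-1)) 0 (pt m (-1) 0 + 1)
  funext ν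
  fin_cases ν
  · simp [pt_zero]
  · rw [Function.update_of_ne (by decide)]; rfl

/-- The fine block at `(0, −1)` is one Λ₀-bond from the base point of `B`. [cite: Balaban1984PropagatorsII, (2.46) p.231] -/
private theorem adj_siteF_zero_siteC : (latC 1 L (fun j => (ΩH j)ᶜ)).Adj (siteF L 0) (siteC L) := by
  refine latC_adj.mpr ⟨siteF_ne_siteC 0, Or.inl ⟨1, ?_⟩⟩
  rw [cornerC_siteC, cornerC_siteF]
  funext ν
  show pt 0 0 ν = pt 0 (-1) ν + (Pi.single (1 : Fin 2) (sideZ 1 L (zoneC (siteF L 0))) : Fin 2 → ℤ) ν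
  have hz : zoneC (siteF L 0) = 0 := rfl
  rw [hz, sideZ, pow_zero, mul_one, Nat.cast_one]
  fin_cases ν
  · simp [pt_zero]
  · simp [pt_one]

/-- **UPPER BOUND (sharpness)**: along the face to the corner and up — `d_R0((m,−1), B) ≤ m + 1` (`m ≥ 0`).
[cite: Balaban1984PropagatorsII, (2.46) p.231] -/
theorem latC_dist_le (m : ℕ) :
    (latC 1 L (fun j => (ΩH j)ᶜ)).dist (siteF L m) (siteC L) ≤ m + 1 := by
  suffices H : ∃ p : (latC 1 L (fun j => (ΩH j)ᶜ)).Walk (siteF L m) (siteC L), p.length = m + 1 by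
    obtain ⟨p, hp⟩ := H
    exact hp ▸ SimpleGraph.dist_le p
  induction m with
  | zero => exact ⟨SimpleGraph.Walk.cons adj_siteF_zero_siteC SimpleGraph.Walk.nil, by simp⟩
  | succ m ih =>
    obtain ⟨p, hp⟩ := ih
    have hadj : (latC 1 L (fun j => (ΩH j)ᶜ)).Adj (siteF L ((m + 1 : ℕ) : ℤ)) (siteF L m) := by
      have := (adj_siteF_succ (L := L) (m : ℤ)).symm
      push_cast
      exact this
    exact ⟨SimpleGraph.Walk.cons hadj p, by simp [hp]⟩

/-- **AT THE FACE CENTRE: d_R2 = 1, d_R0 ≥ ⌊L/2⌋** (`L ≥ 2`): print's distance (2.46) read literally separates two touching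
blocks by ⌊L/2⌋ bonds. [cite: Balaban1984PropagatorsII, (2.46) p.231] -/
theorem half_le_latC_dist_centre (hL : 2 ≤ L) :
    (touchC 1 L (fun j => (ΩH j)ᶜ)).dist (siteF L (L / 2 : ℕ)) (siteC L) = 1 ∧
      L / 2 ≤ (latC 1 L (fun j => (ΩH j)ᶜ)).dist (siteF L (L / 2 : ℕ)) (siteC L) := by
  have h0 : (0 : ℤ) ≤ ((L / 2 : ℕ) : ℤ) := by positivity
  have hm : ((L / 2 : ℕ) : ℤ) < L := by
    have : L / 2 < L := Nat.div_lt_self (by omega) one_lt_two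
    exact_mod_cast this
  refine ⟨touchC_dist_siteF_siteC (by omega) h0 hm, ?_⟩
  have h := min_le_latC_dist hL h0 hm
  have hmin : ((L / 2 : ℕ) : ℤ) ≤ min (((L / 2 : ℕ) : ℤ)) ((L : ℤ) - ((L / 2 : ℕ) : ℤ)) := by
    rw [le_min_iff]
    constructor
    · exact le_rfl
    · have : 2 * (L / 2) ≤ L := Nat.mul_div_le L 2
      omega
  exact_mod_cast hmin.trans h

/-- **THE WITNESS, PACKAGED**: for every `L ≥ 2` there are two TOUCHING blocks of a configuration satisfying (2.1)–(2.2) (and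
every collar hypothesis of the tree) whose touching distance is 1 and whose lattice-contour distance (2.46) is at least
⌊L/2⌋ and at most ⌊L/2⌋ + 1 — the factor between the readings R0 and R2 of G-B6-22 is of order L already at distance one.
[cite: Balaban1984PropagatorsII, (2.46) p.231, (2.51) p.232] -/
theorem exists_touching_far (hL : 2 ≤ L) :
    ∃ s t : CubeSite 1 L (fun j => (ΩH j)ᶜ), Touching s t ∧ (touchC 1 L (fun j => (ΩH j)ᶜ)).dist s t = 1 ∧
      L / 2 ≤ (latC 1 L (fun j => (ΩH j)ᶜ)).dist s t ∧ (latC 1 L (fun j => (ΩH j)ᶜ)).dist s t ≤ L / 2 + 1 := by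
  have h0 : (0 : ℤ) ≤ ((L / 2 : ℕ) : ℤ) := by positivity
  have hm : ((L / 2 : ℕ) : ℤ) < L := by
    have : L / 2 < L := Nat.div_lt_self (by omega) one_lt_two
    exact_mod_cast this
  obtain ⟨h1, h2⟩ := half_le_latC_dist_centre hL
  exact ⟨siteF L (L / 2 : ℕ), siteC L, touching_siteF_siteC (by omega) h0 hm, h1, h2, latC_dist_le (L / 2)⟩

end Bounds

end Literature.MathematicalPhysics.QuantumFieldTheory.Balaban1983to89.B6Dist246InterfaceWitness
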